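import Summits.Parity.GeneralizedHardyLittlewood.Theorems.PrimeLevelFamEdgeIdeaDeltasGaussDiscount
import Literature.NumberTheory.LFunctions.CharacterHarmonicTails
import Literature.NumberTheory.LFunctions.ExceptionalPrimesAbel
import Literature.NumberTheory.LFunctions.ZeroFreeRegionUpTo
import Mathlib.Analysis.SpecialFunctions.Log.Basic
import HarnessLib

/-!
# Route `PrimeLevelFamEdge` — TYPED IDEA DELTAS, deck 32 (LANDING NOTE typer ls-idea-typ-1 gen 4: lens-21 g8's
# `HOME/ls-idea-lens-21/g8/Sketch_L21g8_LayerTwist.lean` rev 2 sha16 5936befb241b2163 VERBATIM up to namespace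
# `…Sketch.Lens21G8.LayerTwist` → `…Theorems.PrimeLevelFamEdgeIdeaDeltas.LayerTwist`; crux idea K-L21-10 `l21-layer-twist-chi-face`
# (tree af8881a90f0cc64b); critics D b130 PASS «HIGH VALUE, LOCATED» and E b26 PASS «deck candidate cleared»; imports deck 29;
# `tendsto_loglog_div_log` made `private` — dedup: = `Literature.NumberTheory.LFunctions.LogWeight.tendsto_log_log_div_log`.)
#
# ls-idea-lens-21 gen 8 — crux idea `l21-layer-twist-chi-face` on K_B (stmt-Parity-20343), node L5′ band R⋆, (S) block

SKETCH (typed + proved bookkeeping, no bound on the heart). The (S) block of one dual modulus `n = |h₁|`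
(`OffDiagCharacterBlock.tsum_levelSmallPart_eq_sum_twist`) carries, for each character `χ mod n`, the twist
`χ((A s)⁻¹)` of the class `a(s) = −ab·(cs)⁻¹`; since `(A s)⁻¹ = −(ab)⁻¹·c·s`, the twist FACTORS as
`χ(−1)·χ̄(ab)·χ(c)·χ(s)` (`twist_factor`): the Petersson LAYER `c = r+1 ∈ [R, 2R]`, `R ≳ C₀ = q̂^η√(λX)/π`, is a
FREE integer variable carrying the non-principal character `χ(c)` against a smooth weight (amplitude `∝ c⁻²`,
phase `e(−lm·j/(q c n))` with `F_row = F/n` turns). On the crown/collar rows (`F_row < F⋆`) nothing else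
oscillates in `c`, so the principal face books the layer count `≍ C₀ ∝ q̂^η` trivially; on the χ-face the same
`c`-sum is a CHARACTER SUM of length `≍ C₀ → ∞`:

* §1 `norm_sum_Ioc_mul_le_window_variation` — finite Abel summation with a window bound `W` for a COMPLEX weight
  of bounded variation: `‖Σ_{N<c≤M} χ(c) f(c)‖ ≤ W·(‖f(M+1)‖ + Σ‖f(c) − f(c+1)‖)`; with the tree's PROVED
  Pólya–Vinogradov window bound (`CharacterTails.norm_window_le_polyaVinogradov`, `W = √d(1 + log d)`) this is
  `norm_layerSum_le_polyaVinogradov`: the layer sum costs `√d(1+log d)·(sup + total variation)` instead of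
  `R·sup` — a saving `≍ √d·(1+F_row)·log d / C₀` that CANCELS the Gauss discount `d^{−1/2}` of K-L21-9 and the
  layer count `q̂^η` at once: the (S)-crown unit per zero becomes `q̂`-POWER-FREE (polylog·N^{β−1}).
* §2 `twist_factor` — the layer carries `χ(c)` (one `map_mul`).
* §3 the re-priced χ-face: `ChiFaceLL C s η N` = no zero of `L(s,χ)`, `1 < cond`, `d ≤ N^η`, `|γ| ≤ (log N)^s`, in
  the LOG-LOG strip `Re ρ > 1 − C·log log N/log N`. PROVED hierarchy: `QuasiGRHFamily σ` for ANY `σ < 1` ⇒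
  `ChiFaceLL` at every large scale (`chiFaceLL_eventually_of_quasiGRHFamily`); the power face `ChiFace η s` ⇒
  `ChiFaceLL C s η′` for `η′ < η` at large scales (`chiFaceLL_of_chiFace`); and ANTI-NESTING
  (`fixed_zero_eventually_admissible`): a FIXED zero `β < 1` satisfies the log-log conclusion at every large scale,
  so the nesting proof of `GaussDiscount.quasiGRHFamily_of_chiFaceIO` (fixed-width box) has no analogue — the i.o.
  log-log face excludes no fixed zero; it is NOT in the class of `Literature.Barriers.Parity.PrimeLevelTransitionZeroFreeBox`.

Standard axioms only. Helper toward `stub_offDiagBelowSlack_io`; closes nothing; no summit statement is proved here.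
«The programme SEARCHES and TYPES; no claim about Landau–Siegel zeros, Theorems 1–2 of arXiv:2211.02515 or a
repaired Margin232 until a kernel theorem says so.»
-/

noncomputable section

open Real Filter Topology Finset Complex
open Summit.Parity.GeneralizedHardyLittlewood.Theorems.PrimeLevelFamEdgeIdeaDeltas.GaussDiscount
open Literature.NumberTheory.LFunctions

namespace Summit.Parity.GeneralizedHardyLittlewood.Theorems.PrimeLevelFamEdgeIdeaDeltas.LayerTwist

/-! ### §1 Abel summation with a window bound and a complex weight of bounded variation -/

/-- **Finite Abel bound, complex weight** (MV Thm. 1.3 in finite form): if `‖Σ_{N<k≤n} χ(k)‖ ≤ W` for all `n`,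
then for ANY `f : ℕ → ℂ`, `‖Σ_{N<n≤M} χ(n) f(n)‖ ≤ W·(‖f(M+1)‖ + Σ_{N<n≤M} ‖f(n) − f(n+1)‖)`.
(The tree's `CharacterTails.norm_sum_Ioc_mul_le_of_window` is the monotone real case.)
[cite: MontgomeryVaughan2007, §1.3 Thm. 1.3] -/
theorem norm_sum_Ioc_mul_le_window_variation {q : ℕ} (χ : DirichletCharacter ℂ q) {W : ℝ} {N : ℕ}
    (hS : ∀ n, ‖∑ k ∈ Ioc N n, χ (k : ZMod q)‖ ≤ W) (f : ℕ → ℂ) (M : ℕ) :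
    ‖∑ n ∈ Ioc N M, χ (n : ZMod q) * f n‖ ≤
      W * (‖f (M + 1)‖ + ∑ n ∈ Ioc N M, ‖f n - f (n + 1)‖) := by
  have hW : 0 ≤ W := le_trans (norm_nonneg _) (hS N)
  rcases le_or_gt N M with h | h
  swap
  · rw [Finset.Ioc_eq_empty (by omega), Finset.sum_empty, Finset.sum_empty, norm_zero]
    positivity
  rw [SiegelZero.sum_Ioc_mul_eq_abel χ f h]
  calc ‖(∑ n ∈ Ioc N M, χ (n : ZMod q)) * f (M + 1) +
        ∑ n ∈ Ioc N M, (∑ k ∈ Ioc N n, χ (k : ZMod q)) * (f n - f (n + 1))‖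
      ≤ ‖(∑ n ∈ Ioc N M, χ (n : ZMod q)) * f (M + 1)‖ +
        ∑ n ∈ Ioc N M, ‖(∑ k ∈ Ioc N n, χ (k : ZMod q)) * (f n - f (n + 1))‖ :=
          (norm_add_le _ _).trans (by gcongr; exact norm_sum_le _ _)
    _ ≤ W * ‖f (M + 1)‖ + ∑ n ∈ Ioc N M, W * ‖f n - f (n + 1)‖ := by
        gcongr with n hn
        · rw [norm_mul]
          exact mul_le_mul_of_nonneg_right (hS M) (norm_nonneg _)
        · rw [norm_mul]
          exact mul_le_mul_of_nonneg_right (hS n) (norm_nonneg _)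
    _ = W * (‖f (M + 1)‖ + ∑ n ∈ Ioc N M, ‖f n - f (n + 1)‖) := by
        rw [← Finset.mul_sum]
        ring

/-- **The PV'd layer sum**: for `χ` PRIMITIVE mod `d ≥ 2` and any complex layer weight `f` on `(R, M]`,
`‖Σ_{R<c≤M} χ(c) f(c)‖ ≤ √d(1 + log d)·(‖f(M+1)‖ + Σ_{R<c≤M} ‖f(c) − f(c+1)‖)` — independent of the LENGTH
`M − R` (the principal face pays `(M − R)·sup‖f‖` on the same rows). Tree inputs: `polyaVinogradov` (PROVED).
[cite: MontgomeryVaughan2007, §9.4 Thm. 9.18] -/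
theorem norm_layerSum_le_polyaVinogradov {d : ℕ} (hd : 2 ≤ d) {χ : DirichletCharacter ℂ d}
    (hχ : χ.IsPrimitive) (f : ℕ → ℂ) (R M : ℕ) :
    ‖∑ c ∈ Ioc R M, χ (c : ZMod d) * f c‖ ≤
      Real.sqrt d * (1 + Real.log d) * (‖f (M + 1)‖ + ∑ c ∈ Ioc R M, ‖f c - f (c + 1)‖) :=
  norm_sum_Ioc_mul_le_window_variation χ
    (fun n => CharacterTails.norm_window_le_polyaVinogradov χ hχ hd R n) f M

/-! ### §2 The layer carries the character -/

/-- **Twist factorisation**: with `(A s)⁻¹ = −x·c·s` (`x = (ab)⁻¹` on the unit stratum), the twist of the (S) block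
is `χ(−1)·χ(x)·χ(c)·χ(s)` — the Petersson layer `c` carries `χ(c)`. [folklore] -/
theorem twist_factor {n : ℕ} (χ : DirichletCharacter ℂ n) (x c s : ZMod n) :
    χ (-(x * c * s)) = χ (-1) * χ x * χ c * χ s := by
  have h : -(x * c * s) = (-1) * x * c * s := by ring
  rw [h, map_mul, map_mul, map_mul]

/-! ### §3 The re-priced χ-face: a LOG-LOG strip, and its place in the hierarchy -/

/-- **The log-log χ-face at scale `N`**: no `L(s,χ)` with `1 < d ≤ N^η` (modulus `d`; the principal face `d = 1`
is NOT included) has a zero with `|Im ρ| ≤ (log N)^s` in the strip `1 − C·log log N/log N < Re ρ < 1`. This is what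
the crown rows of (S) consume once the layer character sum is booked by Pólya–Vinogradov (per zero
`polylog(N)·N^{Re ρ−1}` instead of `N^{(η−ν)/2}·N^{Re ρ−1}`). -/
def ChiFaceLL (C s η N : ℝ) : Prop :=
  ∀ (d : ℕ) [NeZero d] (χ : DirichletCharacter ℂ d), 1 < d → (d : ℝ) ≤ N ^ η →
    ∀ ρ : ℂ, χ.LFunction ρ = 0 → |ρ.im| ≤ Real.log N ^ s → ρ.re < 1 →
      ρ.re ≤ 1 - C * (Real.log (Real.log N) / Real.log N)

/-- The log-log χ-face infinitely often in the scale. -/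
def ChiFaceLLIO (C s η : ℝ) : Prop :=
  ∀ N₀ : ℝ, ∃ N : ℝ, N₀ ≤ N ∧ ChiFaceLL C s η N

/-- The log-log χ-face at every large scale. -/
def ChiFaceLLEv (C s η : ℝ) : Prop :=
  ∃ N₀ : ℝ, ∀ N : ℝ, N₀ ≤ N → ChiFaceLL C s η N

/-- `log log N / log N → 0`. [folklore] -/
private theorem tendsto_loglog_div_log :
    Tendsto (fun N : ℝ => Real.log (Real.log N) / Real.log N) atTop (𝓝 0) :=
  (Real.isLittleO_log_id_atTop.comp_tendsto Real.tendsto_log_atTop).tendsto_div_nhds_zero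

/-- Eventually `C·log log N/log N ≤ ε` for every `ε > 0`. [folklore] -/
theorem eventually_mul_loglog_div_log_le (C : ℝ) {ε : ℝ} (hε : 0 < ε) :
    ∀ᶠ N : ℝ in atTop, C * (Real.log (Real.log N) / Real.log N) ≤ ε := by
  have h : Tendsto (fun N : ℝ => C * (Real.log (Real.log N) / Real.log N)) atTop (𝓝 (C * 0)) :=
    tendsto_loglog_div_log.const_mul C
  rw [mul_zero] at h
  exact (h.eventually (Iic_mem_nhds hε)).mono fun N hN => hN

/-- Trivially the every-scale face gives the i.o. face. -/
theorem chiFaceLLIO_of_chiFaceLLEv {C s η : ℝ} (h : ChiFaceLLEv C s η) : ChiFaceLLIO C s η := by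
  obtain ⟨N₀, hN₀⟩ := h
  exact fun N₁ => ⟨max N₀ N₁, le_max_right _ _, hN₀ _ (le_max_left _ _)⟩

/-- **Below every rung of the quasi-GRH ladder**: `QuasiGRHFamily σ` for ANY `σ < 1` gives the log-log face at
every large scale (the strip `Re > 1 − C log log N/log N` is eventually inside `Re > σ`). -/
theorem chiFaceLL_eventually_of_quasiGRHFamily {σ : ℝ} (hσ : σ < 1) (h : QuasiGRHFamily σ) (C s η : ℝ) :
    ChiFaceLLEv C s η := by
  obtain ⟨N₀, hN₀⟩ := eventually_atTop.mp (eventually_mul_loglog_div_log_le C (sub_pos.mpr hσ))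
  refine ⟨N₀, fun N hN d _ χ _ _ ρ hρ _ hre => ?_⟩
  have h1 : ρ.re ≤ σ := not_lt.mp fun hlt => h d χ ρ hρ hlt hre
  have h2 := hN₀ N hN
  linarith

/-- **ANTI-NESTING**: a FIXED real part `β < 1` is admissible for the log-log face at every large scale — the box
width `C log log N/log N → 0`, so no fixed zero of any fixed `L(s,χ)` is excluded by `ChiFaceLLIO`/`ChiFaceLLEv`;
contrast `GaussDiscount.quasiGRHFamily_of_chiFaceIO`, where the fixed width `η/2` nests every offending zero
into all large boxes. [folklore] -/
theorem fixed_zero_eventually_admissible {β : ℝ} (hβ : β < 1) (C : ℝ) :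
    ∀ᶠ N : ℝ in atTop, β ≤ 1 - C * (Real.log (Real.log N) / Real.log N) :=
  (eventually_mul_loglog_div_log_le C (sub_pos.mpr hβ)).mono fun N hN => by linarith

/-- The same, for one zero of one `L(s,χ)`: whatever `d`, `χ`, `ρ` (with `Re ρ < 1`), the conclusion of
`ChiFaceLL C s η N` holds for this `ρ` at every large scale `N`. -/
theorem single_zero_eventually_admissible {d : ℕ} [NeZero d] (χ : DirichletCharacter ℂ d) {ρ : ℂ}
    (_hρ : χ.LFunction ρ = 0) (hre : ρ.re < 1) (C : ℝ) :
    ∀ᶠ N : ℝ in atTop, ρ.re ≤ 1 - C * (Real.log (Real.log N) / Real.log N) :=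
  fixed_zero_eventually_admissible hre C

/-- **The power face dominates the log-log face** (strictly inside the conductor range): for `η′ < η`, at every
large scale `ChiFace η s N → ChiFaceLL C s η′ N` (for `d ≤ N^{η′}` the power depth `(η − log d/log N)/2 ≥ (η−η′)/2`
eventually exceeds `C log log N/log N`). -/
theorem chiFaceLL_of_chiFace {η η' : ℝ} (hη : η' < η) (C s : ℝ) :
    ∃ N₀ : ℝ, ∀ N : ℝ, N₀ ≤ N → ChiFace η s N → ChiFaceLL C s η' N := by
  obtain ⟨N₁, hN₁⟩ := eventually_atTop.mp
    (eventually_mul_loglog_div_log_le C (by linarith : 0 < (η - η') / 2))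
  refine ⟨max N₁ 2, fun N hN hface d _ χ hd hdN ρ hρ him hre => ?_⟩
  have hN2 : (2 : ℝ) ≤ N := le_trans (le_max_right _ _) hN
  have hNpos : 0 < N := by linarith
  have hlogN : 0 < Real.log N := Real.log_pos (by linarith)
  have hdpos : (0 : ℝ) < d := by exact_mod_cast (by omega : 0 < d)
  -- conductor inside the power face's range: d ≤ N^η' ≤ N^η
  have hdη : (d : ℝ) ≤ N ^ η :=
    hdN.trans (Real.rpow_le_rpow_of_exponent_le (by linarith) hη.le)
  -- the relief log d / log N ≤ η'
  have hrel : Real.log d / Real.log N ≤ η' := by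
    rw [div_le_iff₀ hlogN]
    have h1 : Real.log d ≤ Real.log (N ^ η') := Real.log_le_log hdpos hdN
    rw [Real.log_rpow hNpos] at h1
    linarith
  have hρle := hface d χ hdη ρ hρ him hre
  have hC := hN₁ N (le_trans (le_max_left _ _) hN)
  linarith


/-! ### §5 Small conductors are covered by an exception-free classical region (D P-b130-3)

`ChiFaceLL` is a Linnik-type statement about LARGE conductors only: for conductors `3 ≤ d ≤ Q` an
exception-free classical region `ZeroFreeRegionUpTo Q R M₀` (tree, McCurley-shape, all characters
mod `d` incl. principal/imprimitive) already gives the log-log conclusion at height `(log N)^s` as soon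
as `R·log max(Q·max(1,(log N)^s), M₀) ≤ log N/(C·log log N)` — i.e. for `Q` up to `N^{1/(RC·log log N)}`
roughly; conductors above `N^η` are paid by the Gauss discount alone. So the hedge quantifies in effect
over the GROWING window `[N^{1/(RC log log N)}, N^η]`. -/

/-- **Small conductors: the exception-free classical region up to level `Q` implies the log-log
conclusion** for every character mod `d`, `3 ≤ d ≤ Q`, at height `≤ (log N)^s`, provided the region's
width at `(Q, Q(log N)^s, M₀)` is at least `C log log N/log N`. [folklore] -/
theorem ll_of_zeroFreeRegionUpTo {Q : ℕ} {R M₀ : ℝ} (h : ZeroFreeRegionUpTo Q R M₀) (hR : 0 < R)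
    (hM₀ : 1 < M₀) {C s N : ℝ} (hC : 0 < C) (hN : 1 < Real.log N)
    (hfit : R * Real.log (max ((Q : ℝ) * max 1 (Real.log N ^ s)) M₀) ≤
      Real.log N / (C * Real.log (Real.log N)))
    {d : ℕ} [NeZero d] (hd3 : 3 ≤ d) (hdQ : d ≤ Q) (χ : DirichletCharacter ℂ d) {ρ : ℂ}
    (hρ : χ.LFunction ρ = 0) (him : |ρ.im| ≤ Real.log N ^ s) (hre : ρ.re < 1) :
    ρ.re ≤ 1 - C * (Real.log (Real.log N) / Real.log N) := by
  rw [← not_lt]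
  intro hlt
  have hne : ρ ≠ 1 := by
    intro h1
    rw [h1] at hre
    simp at hre
  have hllN : 0 < Real.log (Real.log N) := Real.log_pos hN
  have hlogN : 0 < Real.log N := by linarith
  set Md : ℝ := max (max (d : ℝ) ((d : ℝ) * |ρ.im|)) M₀ with hMd
  set MQ : ℝ := max ((Q : ℝ) * max 1 (Real.log N ^ s)) M₀ with hMQ
  have hdQ' : (d : ℝ) ≤ Q := by exact_mod_cast hdQ
  have hMd_le : Md ≤ MQ := by
    refine max_le_max (max_le ?_ ?_) le_rfl
    · calc (d : ℝ) ≤ Q := hdQ'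
        _ = Q * 1 := (mul_one _).symm
        _ ≤ Q * max 1 (Real.log N ^ s) := by gcongr; exact le_max_left _ _
    · calc (d : ℝ) * |ρ.im| ≤ Q * Real.log N ^ s := by gcongr
        _ ≤ Q * max 1 (Real.log N ^ s) := by gcongr; exact le_max_right _ _
  have hMd_pos : 1 < Md := lt_of_lt_of_le hM₀ (le_max_right _ _)
  have hlogMd : 0 < Real.log Md := Real.log_pos hMd_pos
  have hlogle : Real.log Md ≤ Real.log MQ := Real.log_le_log (by linarith) hMd_le
  have hRM : 0 < R * Real.log Md := mul_pos hR hlogMd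
  have h1 : R * Real.log Md ≤ Real.log N / (C * Real.log (Real.log N)) :=
    (mul_le_mul_of_nonneg_left hlogle hR.le).trans hfit
  have hA : R * Real.log Md * (C * Real.log (Real.log N)) ≤ Real.log N :=
    (le_div_iff₀ (mul_pos hC hllN)).1 h1
  have h2 : C * (Real.log (Real.log N) / Real.log N) ≤ 1 / (R * Real.log Md) := by
    rw [mul_div_assoc', div_le_div_iff₀ hlogN hRM]
    calc C * Real.log (Real.log N) * (R * Real.log Md)
        = R * Real.log Md * (C * Real.log (Real.log N)) := by ring
      _ ≤ Real.log N := hA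
      _ = 1 * Real.log N := (one_mul _).symm
  have hreg : 1 - 1 / (R * Real.log Md) < ρ.re := by linarith
  exact h d hd3 hdQ χ ρ hne hreg hρ

/-- The same, packaged in `ChiFaceLL`-shape for the small-conductor window `3 ≤ d ≤ Q`: on that window
the log-log face is a THEOREM-SHAPE consequence of an exception-free classical region (hypothesis),
so `ChiFaceLL` proper concerns only conductors `Q < d ≤ N^η`. [folklore] -/
theorem chiFaceLL_smallConductor_of_zeroFreeRegionUpTo {Q : ℕ} {R M₀ : ℝ}
    (h : ZeroFreeRegionUpTo Q R M₀) (hR : 0 < R) (hM₀ : 1 < M₀) {C s N : ℝ} (hC : 0 < C)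
    (hN : 1 < Real.log N)
    (hfit : R * Real.log (max ((Q : ℝ) * max 1 (Real.log N ^ s)) M₀) ≤
      Real.log N / (C * Real.log (Real.log N))) :
    ∀ (d : ℕ) [NeZero d] (χ : DirichletCharacter ℂ d), 3 ≤ d → d ≤ Q →
      ∀ ρ : ℂ, χ.LFunction ρ = 0 → |ρ.im| ≤ Real.log N ^ s → ρ.re < 1 →
        ρ.re ≤ 1 - C * (Real.log (Real.log N) / Real.log N) :=
  fun _ _ χ hd3 hdQ _ hρ him hre ↦ ll_of_zeroFreeRegionUpTo h hR hM₀ hC hN hfit hd3 hdQ χ hρ him hre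

end Summit.Parity.GeneralizedHardyLittlewood.Theorems.PrimeLevelFamEdgeIdeaDeltas.LayerTwist

end
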